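/-
COR-CM (cells pub-hodgecm / pub-hodgecm2, Hodge ladder stage 2) — TRANSPOSITION item (vi), sub-binder S2 `supply`
(hodge-director/ITEM6-SPLIT.md §(c)/§5), CM side of the object match: the GALOIS IDENTITY behind (C6b*).  Written by
the stage-1 binder seat pub-hodgecm-mc-binder-1 (gen 21, prover-pub-hodgecm-mc-binder-1-g21-0) in its own count-neutral
lane (theorems only: no definition, no named fact, nothing asserted; nothing under `CorCM/B01/` is edited or restated —
the inverse-type relation of item (ii) (`Transposition.invType`, `comp_mem_invType_iff`) is written INLINE as a hypothesis,
exactly as in `Transposition/Item2Reflex.lean`, so that this file imports Literature only).  HC_CM is NOT proved.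
-/
import Literature.NumberTheory.ComplexMultiplication.ReflexCMType
import Literature.NumberTheory.ComplexMultiplication.CMGaloisSubfield
import Literature.NumberTheory.ComplexMultiplication.InducedCMType
import HarnessLib

/-!
# The reflex pair of the inverse type `Φ^{*ι₁}` is a sub-pair INDUCING `Φ`

For a Galois CM field `F`, a complex embedding `ι₁ : F → ℂ` and CM types `Φ, Θ` of `F` INVERSE to each other through `ι₁`
(`hΘ : ∀ g ∈ Gal(F/ℚ), ι₁ ∘ g ∈ Θ ↔ ι₁ ∘ g⁻¹ ∈ Φ`, i.e. `Θ = Φ^{*ι₁} = Transposition.invType ι₁ Φ` of item (ii),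
`Transposition/Item2Holds.lean` `comp_mem_invType_iff` / `eq_invType_of_isInverse`; written inline here), let
`(K*, Θ*)` be the REFLEX PAIR of `(F, Θ)` in the tree's vocabulary (Shimura 1998 §8.3 Prop. 28): `K* = reflexField ℚ F Θ_F ⊆ F`
with `Θ_F = algValuedIn ι₁ Θ ⊆ Gal(F/ℚ)` (`Literature/NumberTheory/ComplexMultiplication/ReflexType.lean`), and
`Θ* = reflexCMType ι₁ Θ id : CMType K*` (`ReflexCMType.lean`, base point the identity of `F`).  Then

  **`inducedCMType_reflexField_val_reflexCMType_of_isInverse`:  `Φ` is the CM type of `F` INDUCED from `(K*, Θ*)` along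
  the inclusion `K* ⊆ F`** — `{τ : F → ℂ | τ|_{K*} ∈ Θ*} = Φ`.

At group level this is `S(Θ*, ι*) = S*(Θ, id) = S(Θ)⁻¹` (tree `typeLift_reflexType` / `comp_smul_val_mem_reflexCMType_iff`)
and `S(Θ)⁻¹ = S(Φ)` (the definition of the inverse type): three lines of Galois bookkeeping, Shimura's "`Φ` is induced by
`Φʳʳ`" applied to `Φʳ`-of-the-inverse.  Also recorded: `K*` is a CM field (`isCMField_reflexField`, for the `[IsCMField K₀]`
binder of the CM-side transfer theorems).

WHY (ITEM6-SPLIT §5, (C6b*) of b01-idea-1 `HOME/b01/IDEA-1l-inverse-type-c6b.md` §1 «Galois identity (three lines)»;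
item6-p1 `S2-ASPRINTED-CHAIN.md` (C6b*)): by [Liu2021] Def. 4.3 (2) / Def. 4.5 (2) (tree `Liu2021.LiuCMData.cmType_eq_induced_of_det45`)
Liu's `A_μ ⊗_{E,ι₁} ℂ` realises over `M_μ` the type induced from the reflex pair `(M'_μ, Ψ_μ)` of `(E, Φ_μ)`; for a character
`μ` of type `Φ_μ = Φ^{*ι₁}` this file says that the SAME pair induces the target type `Φ` on `F = E` — i.e. the hypothesis
«common sub-pair» of the CM-side reach transfer `CMReach.exists_hom_ne_zero_of_common_subpair` /
`Model.exists_hom_cmAV_ne_zero_of_forall_mem_iff` (`CorCM/CMSideReachTransfer.lean`, p279849) is met, whence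
`Hom(A_μ ⊗_{E,ι₁} ℂ, A_{(F,Φ)}) ≠ 0`.  The composition of the two files is a three-line corollary filed separately once both
have tree oleans; nothing here depends on `CMSideReachTransfer.lean`.

References: G. Shimura, *Abelian Varieties with Complex Multiplication and Modular Functions* (1998) §8.3 Prop. 28 and the
paragraph following it; M. Streng, *Complex multiplication of abelian surfaces* (2010) Ch. I Lemma 7.2; Y. Liu, Camb. J. Math. 9
(2021) Def. 4.3 (2), Def. 4.5 (2).
-/

noncomputable section

open scoped Pointwise

namespace Summit.HodgeConjecture.CorCM

namespace CMReach

open Literature.AlgebraicGeometry.Motives (CMType)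
open Literature.NumberTheory.ComplexMultiplication
open NumberField

variable {F : Type} [Field F] [NumberField F] [IsCMField F] [IsGalois ℚ F]

omit [IsCMField F] in
/-- For `F/ℚ` Galois every complex embedding of `F` is `ι₁ ∘ g` for some `g ∈ Gal(F/ℚ)` (normality, tree
`exists_algHom_comp_eq_of_normal`; `Hom_ℚ(F, F) = Gal(F/ℚ)` for an algebraic extension).  (= item (ii)'s
`Transposition.exists_algEquiv_comp_eq`, reproved to keep this file on Literature imports.) [folklore] -/
theorem exists_algEquiv_comp_eq' (ι₁ τ : F →+* ℂ) : ∃ g : F ≃ₐ[ℚ] F, ι₁.comp (g : F →+* F) = τ := by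
  obtain ⟨ψ, hψ⟩ := exists_algHom_comp_eq_of_normal (AlgHom.id ℚ F) ι₁ τ
  refine ⟨(Algebra.IsAlgebraic.algEquivEquivAlgHom ℚ F).symm ψ, ?_⟩
  rw [← hψ]
  rfl

omit [IsCMField F] [IsGalois ℚ F] in
/-- Restricting `ι₁ ∘ g` to an intermediate field `E ⊆ F`: `(ι₁ ∘ g) ∘ (E ⊆ F) = ι₁ ∘ (g • E.val)`. [folklore] -/
theorem comp_algEquiv_comp_val (ι₁ : F →+* ℂ) (E : IntermediateField ℚ F) (g : F ≃ₐ[ℚ] F) :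
    (ι₁.comp (g : F →+* F)).comp (E.val : E →+* F) = ι₁.comp ((g • E.val : E →ₐ[ℚ] F) : E →+* F) :=
  RingHom.ext fun _ => rfl

/-- **Membership form of the Galois identity.**  If `Θ` and `Φ` are inverse through `ι₁` then for `τ = ι₁ ∘ g`:
`τ|_{K*} ∈ Θ*` iff `g ∈ S*(Θ, id)` iff `ι₁ ∘ g⁻¹ ∈ Θ` iff `ι₁ ∘ g ∈ Φ`. [cite: Shimura1998, §8.3 Prop. 28] -/
theorem comp_val_mem_reflexCMType_iff_of_isInverse (ι₁ : F →+* ℂ) {Φ Θ : CMType F}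
    (hΘ : ∀ g : F ≃ₐ[ℚ] F, ι₁.comp (g : F →+* F) ∈ Θ.1 ↔ ι₁.comp (g.symm : F →+* F) ∈ Φ.1) (τ : F →+* ℂ) :
    τ.comp ((reflexField ℚ F (algValuedIn ι₁ Θ.1)).val : reflexField ℚ F (algValuedIn ι₁ Θ.1) →+* F) ∈
      (reflexCMType ι₁ Θ (AlgHom.id ℚ F)).1 ↔ τ ∈ Φ.1 := by
  obtain ⟨g, rfl⟩ := exists_algEquiv_comp_eq' ι₁ τ
  rw [comp_algEquiv_comp_val, comp_smul_val_mem_reflexCMType_iff, mem_reflexLift, mem_algValuedIn_iff]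
  have hg : ((g⁻¹ • AlgHom.id ℚ F : F →ₐ[ℚ] F) : F →+* F) = (g.symm : F →+* F) := RingHom.ext fun _ => rfl
  rw [hg, hΘ g.symm, AlgEquiv.symm_symm]

/-- **The reflex pair of the inverse type induces the type.**  If `Θ = Φ^{*ι₁}` (inverse through `ι₁`:
`ι₁ ∘ g ∈ Θ ↔ ι₁ ∘ g⁻¹ ∈ Φ`), `K* = reflexField ℚ F Θ_F ⊆ F` is the reflex field of `Θ` and `Θ* = reflexCMType ι₁ Θ id` its
reflex CM type, then the CM type of `F` induced from `(K*, Θ*)` along the inclusion `K* ⊆ F` is `Φ`.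
[cite: Shimura1998, §8.3 Prop. 28] [cite: Streng2010, Ch. I Lemma 7.2] -/
theorem inducedCMType_reflexField_val_reflexCMType_of_isInverse (ι₁ : F →+* ℂ) {Φ Θ : CMType F}
    (hΘ : ∀ g : F ≃ₐ[ℚ] F, ι₁.comp (g : F →+* F) ∈ Θ.1 ↔ ι₁.comp (g.symm : F →+* F) ∈ Φ.1) :
    inducedCMType ((reflexField ℚ F (algValuedIn ι₁ Θ.1)).val : reflexField ℚ F (algValuedIn ι₁ Θ.1) →+* F)
      (reflexCMType ι₁ Θ (AlgHom.id ℚ F)) = Φ :=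
  Subtype.ext (Set.ext fun τ =>
    (mem_inducedCMType_iff _ _ τ).trans (comp_val_mem_reflexCMType_iff_of_isInverse ι₁ hΘ τ))

/-- **The same, membership form over `F`** (the shape `∀ τ, τ ∈ Φ ↔ τ ∘ k ∈ Φ₀` consumed by
`Model.exists_hom_cmAV_ne_zero_of_forall_mem_iff` of `CorCM/CMSideReachTransfer.lean`, with `k = K*.val`, `Φ₀ = Θ*`).
[cite: Shimura1998, §8.3 Prop. 28] -/
theorem forall_mem_iff_comp_val_mem_reflexCMType_of_isInverse (ι₁ : F →+* ℂ) {Φ Θ : CMType F}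
    (hΘ : ∀ g : F ≃ₐ[ℚ] F, ι₁.comp (g : F →+* F) ∈ Θ.1 ↔ ι₁.comp (g.symm : F →+* F) ∈ Φ.1) :
    ∀ τ : F →+* ℂ, τ ∈ Φ.1 ↔
      τ.comp ((reflexField ℚ F (algValuedIn ι₁ Θ.1)).val : reflexField ℚ F (algValuedIn ι₁ Θ.1) →+* F) ∈
        (reflexCMType ι₁ Θ (AlgHom.id ℚ F)).1 :=
  fun τ => (comp_val_mem_reflexCMType_iff_of_isInverse ι₁ hΘ τ).symm

omit [IsCMField F] [IsGalois ℚ F] in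
/-- The inverse relation is symmetric (`(g⁻¹)⁻¹ = g`): `Φ = Θ^{*ι₁}` as well. [folklore] -/
theorem isInverse_symm (ι₁ : F →+* ℂ) {Φ Θ : CMType F}
    (hΘ : ∀ g : F ≃ₐ[ℚ] F, ι₁.comp (g : F →+* F) ∈ Θ.1 ↔ ι₁.comp (g.symm : F →+* F) ∈ Φ.1) :
    ∀ g : F ≃ₐ[ℚ] F, ι₁.comp (g : F →+* F) ∈ Φ.1 ↔ ι₁.comp (g.symm : F →+* F) ∈ Θ.1 :=
  fun g => by rw [hΘ g.symm, AlgEquiv.symm_symm]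

/-- … hence also: the reflex pair of `Φ` induces the inverse type `Θ = Φ^{*ι₁}` (roles displayed as in (C6b*): for the
type `Φ_μ` of the character, the reflex pair `(K*, Φ_μ*)` induces `Φ_μ^{*ι₁}`). [cite: Shimura1998, §8.3 Prop. 28] -/
theorem inducedCMType_reflexField_val_reflexCMType_of_isInverse' (ι₁ : F →+* ℂ) {Φ Θ : CMType F}
    (hΘ : ∀ g : F ≃ₐ[ℚ] F, ι₁.comp (g : F →+* F) ∈ Θ.1 ↔ ι₁.comp (g.symm : F →+* F) ∈ Φ.1) :
    inducedCMType ((reflexField ℚ F (algValuedIn ι₁ Φ.1)).val : reflexField ℚ F (algValuedIn ι₁ Φ.1) →+* F)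
      (reflexCMType ι₁ Φ (AlgHom.id ℚ F)) = Θ :=
  inducedCMType_reflexField_val_reflexCMType_of_isInverse ι₁ (isInverse_symm ι₁ hΘ)

omit [IsGalois ℚ F] in
/-- The reflex field `K*` of (the Galois side of) any complex CM type of a Galois CM field is a CM field — so it may serve
as the base field `K₀` of a common sub-pair (`[IsCMField K₀]` in `CorCM/CMSideReachTransfer.lean`).
[cite: Shimura1998, §8.3 Prop. 28] -/
theorem isCMField_reflexField_algValuedIn [IsGalois ℚ F] (ι₁ : F →+* ℂ) (Θ : CMType F) :
    IsCMField (reflexField ℚ F (algValuedIn ι₁ Θ.1)) :=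
  isCMField_reflexField ι₁ Θ (AlgHom.id ℚ F)

end CMReach

end Summit.HodgeConjecture.CorCM

end
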